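import Literature.NumberTheory.EllipticCurves.AtkinLehnerSymbolSymmetryProofs
import Literature.NumberTheory.EllipticCurves.PAdicLFunctionMomentProofs
import HarnessLib

/-!
# Two-sided series and first moment of the twisted `L`-values `L(f ⊗ χ, 1)` over characters of
# `p`-power conductor when `p` DIVIDES the level (Atkin–Lehner flip at the prime-to-`p` part)

Cell `pub/bsd-wall` (D-0145 line `route-BirchSwinnertonDyer-CyclotomicUntwist`), seat `bsd-line-cycu-p5`
(width seat 5), helper toward crux K1 `PSRankOneLowerHalfAtThree` (stmt-BirchSwinnertonDyer-21580):
step 1 of 3 of making «the untwisted `3`-adic `L`-function `𝓛^η_W` of D1 is not identically zero»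
(`CyclotomicUntwistUntwistedNonvanishing`, there modulo a Rohrlich-1989-type hypothesis `hR`)
UNCONDITIONAL. THEOREMS ONLY (no definition, no named fact, no `sorry`); BSD is not proved by this
file and no crux is. Route-free modular-form content (namespace `…Theorems.PSTwistedMomentAtLevel`).

The tree's "approximate functional equation in exact form" for the twisted symbol sums
`∑_{a mod m} χ̄(a){∞, a/m}_f` (`twistedSymbolSum_inv_eq_dampedTwist`, `TwistedLValueSeries`) and the
first-moment identity / non-vanishing built on it (`sum_wildChars_twistedSymbolSum_eq`,
`exists_wildChars_twistedSymbolSum_ne_zero`, `PAdicLFunctionMomentProofs`) flip the ray `u/m + it`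
by the FRICKE involution `w_N`, which requires `(m, N) = 1` — so for characters of `p`-power
conductor they need `p ∤ N`. When `p ∣ N` the flip is instead the ATKIN–LEHNER one at the exact
divisor `Q ∥ N` with `p ∤ Q` and `N ∣ Q p^m` (i.e. `Q` = the prime-to-`p` part of `N`,
`m ≥ v_p(N)`), already in the tree as `apply_ofComplex_eq_of_atkinLehner` /
`modularSymbol_eq_rayTail_sub_atkinLehner` (`AtkinLehnerSymbolSymmetryProofs`; Knapp 1993, Lemma 9.24;
Mazur–Tate–Teitelbaum 1986, §I.17): for `w_Q f = ε f`, `a m − u Q v = 1`,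
`{∞, u/m}_f = T_f(u/m, Y) − ε T_f(v/m, 1/(Q m² Y))`. This file runs the finite Fourier analysis and
the moment identity of the two source files on top of that flip, with `N` replaced by `Q`
throughout (dual weight `χ(Q) τ(χ)²`, dual damping `1/(Q m² Y)`):

* `twistedSymbolSum_inv_eq_dampedTwist_atkinLehner` — for `χ` primitive mod `m`, `(m, Q) = 1`,
  `N ∣ Q m`: `∑_a χ̄(a){∞, a/m}_f = τ(χ̄) D_f(χ, Y) − ε χ̄(−1) χ(Q) τ(χ) D_f(χ̄, 1/(Q m² Y))`
  (for a newform this is the functional equation of `L(f ⊗ χ, s)` at a character ramified at primes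
  dividing the level, Atkin–Li 1978 §3–§4, with root number `ε_Q χ(Q) τ(χ)²/m` — the local constant
  at `p` of the twist being `ε(χ_p)²` once `cond(χ_p)` exceeds the `p`-part of `N`);
* `sum_wildChars_twistedSymbolSum_eq_atkinLehner` — the first-moment identity over the wild
  characters `𝔛_m` of conductor `p^m` (`wildChars`), `p ∤ Q`, `N ∣ Q p^m`:
  `∑_{χ ∈ 𝔛_m} (τ(χ)/p^m) ∑_a χ̄(a){∞, a/p^m}_f = D_f(A, Y) − (ε/p^m) D_f(B_Q, 1/(Q p^{2m} Y))`,
  `A = ∑_χ χ`, `B_Q(n) = ∑_χ χ(Q) τ(χ)² χ̄(n)`;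
* `norm_dampedTwist_weight_le` — `‖D_g(w, Y')‖ ≤ K · C · (1 + Γ(θ)(2πY')^{-θ})` for any weight with
  `‖w(n)‖ ≤ K` and `|bₙ(g)| ≤ C n^θ` (the analytic half of `norm_dampedTwist_dual_le`, made generic);
* `norm_dampedTwist_dual_le_of_not_dvd` — the dual-term error with weight `B_Q`, `p ∤ Q`
  (Kloosterman bound `norm_sum_wildChars_mul_gaussSum_sq_le`), verbatim the bound of
  `norm_dampedTwist_dual_le` (which is the case `Q = N`).

The non-vanishing of the first moment for large `m` at a prime DIVIDING the level, and its use
(`𝓛^η ≢ 0`), are in the companions `CyclotomicUntwistNonvanishingTwistsAtLevel` and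
`CyclotomicUntwistUntwistedNonvanishingUnconditional`.

References: D. E. Rohrlich, *On `L`-functions of elliptic curves and cyclotomic towers*, Invent. Math.
75 (1984), 409–423, §2–§3 (the method at `p ∤ N`) [cite: RohrlichInventiones1984, §2–§3];
A. O. L. Atkin, W.-C. W. Li, *Twists of newforms and pseudo-eigenvalues of `W`-operators*, Invent.
Math. 48 (1978), 221–243, §3–§4; A. W. Knapp, *Elliptic curves*, Math. Notes 40 (1993), Lemma 9.24,
Thm. 9.27 [cite: Knapp1993, Lemma 9.24]; B. Mazur, J. Tate, J. Teitelbaum, Invent. Math. 84 (1986),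
§I.17 [cite: MazurTateTeitelbaum1986Invent, §I.17].
-/

noncomputable section

open scoped MatrixGroups ModularForm BigOperators Real

open CongruenceSubgroup UpperHalfPlane Complex MeasureTheory Set Finset
  Literature.NumberTheory.EllipticCurves Literature.NumberTheory.EllipticCurves.ModularForms

-- single-conjunct summit: `Summit.BirchSwinnertonDyer.BirchSwinnertonDyer.…` repeats the name by design
set_option linter.dupNamespace false
set_option autoImplicit false

namespace Summit.BirchSwinnertonDyer.BirchSwinnertonDyer.Theorems.PSTwistedMomentAtLevel

/-! ### The two-sided series for `∑ χ̄(a){∞, a/m}_f`, Atkin–Lehner form -/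

section Twist

variable {N : ℕ} [NeZero N] (f : CuspForm (Gamma0 N) 2) {Q : ℕ} [NeZero Q] {m : ℕ} [NeZero m]

/-- **Two-sided series for the twisted symbol sums, Atkin–Lehner form** (the exact "approximate
functional equation" for `L(f ⊗ χ, 1)` in weight `2` at a character whose conductor may share
primes with the level). Let `f ∈ S_2(Γ₀(N))` satisfy `w_Q f = ε f` for an exact divisor `Q ∥ N`
(`ε² = 1`), let `χ` be a *primitive* Dirichlet character mod `m` with `(m, Q) = 1` and `N ∣ Q m`,
and `Y > 0`. Then
`∑_{a mod m} χ̄(a) {∞, a/m}_f = τ(χ̄) · D_f(χ, Y) - ε · χ̄(-1) χ(Q) τ(χ) · D_f(χ̄, 1/(Q m² Y))`,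
`D_f(w, y) = ∑ w(n) aₙ e^{-2πny}/n` (`dampedTwist`). Proof: `modularSymbol_eq_rayTail_sub_atkinLehner`
at the units `a` (flip datum `a' m − a Q v = 1`, `v ≡ −(aQ)⁻¹`, `exists_int_flip`), then
`∑_a χ̄(a) e(an/m) = χ(n) τ(χ̄)` and `∑_a χ̄(a) e(−(aQ)⁻¹ n/m) = χ̄(−1) χ(Q) χ̄(n) τ(χ)`
(`sum_inv_mul_stdAddChar_flip`). The Fricke case `Q = N` is `twistedSymbolSum_inv_eq_dampedTwist`.
[folklore] -/
theorem twistedSymbolSum_inv_eq_dampedTwist_atkinLehner (hQN : Q ∣ N) (hc : Nat.Coprime Q (N / Q))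
    {ε : ℂ} (hε : atkinLehnerInvolution N 2 Q f = ε • f) (hε1 : ε ^ 2 = 1)
    (hmQ : m.Coprime Q) (hNm : N ∣ Q * m)
    {χ : DirichletCharacter ℂ m} (hχ : χ.IsPrimitive) {Y : ℝ} (hY : 0 < Y) :
    twistedSymbolSum f χ⁻¹ =
      gaussSum χ⁻¹ (ZMod.stdAddChar (N := m)) * dampedTwist f (fun n ↦ χ n) Y -
        ε * (χ⁻¹ (-1) * χ Q * gaussSum χ (ZMod.stdAddChar (N := m))) *
          dampedTwist f (fun n ↦ χ⁻¹ n) (1 / ((Q : ℝ) * m ^ 2 * Y)) := by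
  have hQ : (0 : ℝ) < Q := Nat.cast_pos.mpr (NeZero.pos Q)
  have hY' : 0 < 1 / ((Q : ℝ) * m ^ 2 * Y) := by
    have : (0 : ℝ) < m := Nat.cast_pos.mpr (NeZero.pos m)
    positivity
  set V : ZMod m → ZMod m := fun x ↦ -(x * (Q : ZMod m))⁻¹ with hV
  -- the two-sided formula at the units
  have hunit : ∀ x : ZMod m, IsUnit x → modularSymbol f ((x.val : ℚ) / m) =
      rayTail f ((x.val : ℚ) / m) Y - ε * rayTail f (((V x).val : ℚ) / m) (1 / ((Q : ℝ) * m ^ 2 * Y)) := by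
    intro x hx
    obtain ⟨a, ha⟩ := exists_int_flip hmQ hx
    have h := modularSymbol_eq_rayTail_sub_atkinLehner hQN hc f hε hε1 (NeZero.pos m) hNm ha hY
    simpa only [Int.cast_natCast] using h
  -- expand the twisted symbol sum
  have hexp : twistedSymbolSum f χ⁻¹ =
      ∑ x : ZMod m, χ⁻¹ x * rayTail f ((x.val : ℚ) / m) Y -
        ε * ∑ x : ZMod m, χ⁻¹ x * rayTail f (((V x).val : ℚ) / m) (1 / ((Q : ℝ) * m ^ 2 * Y)) := by
    rw [twistedSymbolSum, Finset.mul_sum, ← Finset.sum_sub_distrib]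
    refine Finset.sum_congr rfl fun x _ ↦ ?_
    by_cases hx : IsUnit x
    · rw [hunit x hx]; ring
    · rw [MulChar.map_nonunit _ hx]; ring
  have hA : ∑ x : ZMod m, χ⁻¹ x * rayTail f ((x.val : ℚ) / m) Y =
      gaussSum χ⁻¹ (ZMod.stdAddChar (N := m)) * dampedTwist f (fun n ↦ χ n) Y := by
    have h1 := sum_mul_rayTail_eq_tsum f (fun x ↦ χ⁻¹ x) id hY
    simp only [id] at h1
    rw [h1, dampedTwist, ← tsum_mul_left]
    exact tsum_congr fun n ↦ by rw [sum_inv_mul_stdAddChar χ hχ n]; ring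
  have hB : ∑ x : ZMod m, χ⁻¹ x * rayTail f (((V x).val : ℚ) / m) (1 / ((Q : ℝ) * m ^ 2 * Y)) =
      (χ⁻¹ (-1) * χ Q * gaussSum χ (ZMod.stdAddChar (N := m))) *
        dampedTwist f (fun n ↦ χ⁻¹ n) (1 / ((Q : ℝ) * m ^ 2 * Y)) := by
    rw [sum_mul_rayTail_eq_tsum f (fun x ↦ χ⁻¹ x) V hY', dampedTwist, ← tsum_mul_left]
    refine tsum_congr fun n ↦ ?_
    rw [hV]
    dsimp only
    rw [sum_inv_mul_stdAddChar_flip hmQ χ n, gaussSum_mulShift_of_isPrimitive _ hχ]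
    ring
  rw [hexp, hA, hB]
  ring

end Twist

/-! ### The first-moment identity with the Atkin–Lehner flip -/

section MomentIdentity

variable {N : ℕ} [NeZero N] (f : CuspForm (Gamma0 N) 2) {p : ℕ} [Fact p.Prime] {Q : ℕ} [NeZero Q]

/-- **The first-moment identity at a prime dividing the level.** Let `f ∈ S_2(Γ₀(N))` with
`w_Q f = ε f` for an exact divisor `Q ∥ N` with `p ∤ Q` and `N ∣ Q p^m` (so `Q` is the
prime-to-`p` part of `N` and `m ≥ v_p(N)`; `ε² = 1`), `Y > 0`, `Y' = 1/(Q p^{2m} Y)`. Summing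
`twistedSymbolSum_inv_eq_dampedTwist_atkinLehner` against the weights `τ(χ)/p^m = τ(χ̄)⁻¹` over the
wild characters `χ ∈ 𝔛_m` (even, `τ(χ)τ(χ̄) = p^m`):
`∑_{χ ∈ 𝔛_m} (τ(χ)/p^m) ∑_a χ(a){∞, a/p^m}_f = D_f(A, Y) - (ε/p^m) D_f(B_Q, Y')` with
`A(n) = ∑_χ χ(n)` and `B_Q(n) = ∑_χ χ(Q) τ(χ)² χ̄(n)`. The case `p ∤ N`, `Q = N` (Fricke) is
`sum_wildChars_twistedSymbolSum_eq` (Rohrlich 1984, §3). [folklore] -/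
theorem sum_wildChars_twistedSymbolSum_eq_atkinLehner (hQN : Q ∣ N) (hc : Nat.Coprime Q (N / Q))
    {ε : ℂ} (hε : atkinLehnerInvolution N 2 Q f = ε • f) (hε1 : ε ^ 2 = 1) (hpQ : ¬ p ∣ Q)
    {m : ℕ} [NeZero (p ^ m)] (hNm : N ∣ Q * p ^ m) {Y : ℝ} (hY : 0 < Y) :
    ∑ χ ∈ wildChars p m, gaussSum χ (ZMod.stdAddChar (N := p ^ m)) / (p ^ m : ℂ) *
        twistedSymbolSum f χ⁻¹ =
      dampedTwist f (fun n ↦ ∑ χ ∈ wildChars p m, χ n) Y -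
        ε / (p ^ m : ℂ) * dampedTwist f (fun n ↦ ∑ χ ∈ wildChars p m,
          χ Q * gaussSum χ (ZMod.stdAddChar (N := p ^ m)) ^ 2 * χ⁻¹ n) (1 / ((Q : ℝ) * (p ^ m : ℕ) ^ 2 * Y)) := by
  have hp : p.Prime := Fact.out
  have hmQ : (p ^ m).Coprime Q := Nat.Coprime.pow_left _ ((Nat.Prime.coprime_iff_not_dvd hp).mpr hpQ)
  have hY' : 0 < 1 / ((Q : ℝ) * (p ^ m : ℕ) ^ 2 * Y) := by
    have : (0 : ℝ) < Q := Nat.cast_pos.mpr (NeZero.pos Q)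
    have : (0 : ℝ) < (p ^ m : ℕ) := Nat.cast_pos.mpr (NeZero.pos _)
    positivity
  have hpm : ((p ^ m : ℕ) : ℂ) ≠ 0 := Nat.cast_ne_zero.mpr (NeZero.ne _)
  -- termwise
  have hterm : ∀ χ ∈ wildChars p m,
      gaussSum χ (ZMod.stdAddChar (N := p ^ m)) / (p ^ m : ℂ) * twistedSymbolSum f χ⁻¹ =
        (1 : ℂ) * dampedTwist f (fun n ↦ χ n) Y -
          ε / (p ^ m : ℂ) * ((χ Q * gaussSum χ (ZMod.stdAddChar (N := p ^ m)) ^ 2) *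
            dampedTwist f (fun n ↦ χ⁻¹ n) (1 / ((Q : ℝ) * (p ^ m : ℕ) ^ 2 * Y))) := by
    intro χ hχ
    obtain ⟨hprim, heven, -⟩ := (mem_wildChars χ).mp hχ
    have h := twistedSymbolSum_inv_eq_dampedTwist_atkinLehner f hQN hc hε hε1 hmQ hNm hprim hY
    have hgg := Literature.NumberTheory.Sieve.LargeSieve.gaussSum_mul_gaussSum_inv hprim
    have h1 : χ⁻¹ (-1) = 1 := by rw [MulChar.inv_apply_eq_inv', heven, inv_one]
    rw [heven, one_mul] at hgg
    push_cast at h hgg ⊢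
    rw [h, h1]
    have hpm' : (p : ℂ) ^ m ≠ 0 := by exact_mod_cast hpm
    field_simp
    linear_combination dampedTwist f (fun n ↦ χ n) Y * hgg
  rw [Finset.sum_congr rfl hterm, Finset.sum_sub_distrib]
  congr 1
  · rw [sum_mul_dampedTwist f (wildChars p m) (fun _ ↦ (1 : ℂ))
      (fun (χ : DirichletCharacter ℂ (p ^ m)) (n : ℕ) ↦ χ n) (B := 1)
      (fun χ n ↦ DirichletCharacter.norm_le_one χ _) hY]
    simp
  · rw [← Finset.mul_sum, sum_mul_dampedTwist f (wildChars p m) _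
      (fun (χ : DirichletCharacter ℂ (p ^ m)) (n : ℕ) ↦ χ⁻¹ n) (B := 1)
      (fun χ n ↦ DirichletCharacter.norm_le_one χ⁻¹ _) hY']

end MomentIdentity

/-! ### The dual-term error with weight `χ(Q) τ(χ)²` -/

section Errors

variable {N : ℕ} (g : CuspForm (Gamma0 N) 2) {p : ℕ} [hp : Fact p.Prime]

/-- **Damped sums against a bounded weight.** For a cusp form `g ∈ S_2(Γ₀(N))` with
`|bₙ| ≤ C n^θ` (`0 < θ ≤ 1`), a weight `w` with `‖w(n)‖ ≤ K` (`K ≥ 0`) and `Y' > 0`: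
`‖D_g(w, Y')‖ ≤ K · C · (1 + Γ(θ) (2πY')^{-θ})` — the terms are majorised by
`K C n^{θ-1} e^{-2πY' n}` and `∑_{n ≥ 1} n^{θ-1}e^{-un} ≤ 1 + Γ(θ)u^{-θ}`
(`sum_range_rpow_mul_exp_le`). [folklore] -/
theorem norm_dampedTwist_weight_le {C θ : ℝ} (hC : 0 ≤ C) (hθ : 0 < θ) (hθ1 : θ ≤ 1)
    (hb : ∀ n : ℕ, ‖cuspCoeff g n‖ ≤ C * (n : ℝ) ^ θ) {w : ℕ → ℂ} {K : ℝ} (hK : 0 ≤ K)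
    (hw : ∀ n : ℕ, ‖w n‖ ≤ K) {Y' : ℝ} (hY' : 0 < Y') :
    ‖dampedTwist g w Y'‖ ≤ K * C * (1 + Real.Gamma θ * (2 * Real.pi * Y') ^ (-θ)) := by
  set c : ℝ := 2 * Real.pi * Y' with hc
  have hcpos : 0 < c := by positivity
  -- the majorant (zero at `n = 0`, where the term vanishes)
  set h : ℕ → ℝ := fun n ↦
    if n = 0 then 0 else K * C * ((n : ℝ) ^ (θ - 1) * Real.exp (-c * n)) with hh
  have hh0 : ∀ n, 0 ≤ h n := fun n ↦ by
    simp only [hh]; split_ifs <;> positivity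
  have hh_le : ∀ n, h n ≤ K * C * ((n : ℝ) ^ (θ - 1) * Real.exp (-c * n)) := fun n ↦ by
    simp only [hh]; split_ifs <;> first | positivity | exact le_rfl
  have hh_summable : Summable h :=
    Summable.of_nonneg_of_le hh0 hh_le ((summable_rpow_mul_exp hθ1 hcpos).mul_left _)
  have hpt : ∀ n : ℕ, ‖w n * cuspCoeff g n * (Real.exp (-(2 * Real.pi * n) * Y') / n : ℝ)‖ ≤ h n := by
    intro n
    rcases Nat.eq_zero_or_pos n with rfl | hnpos
    · simp only [Nat.cast_zero, div_zero, Complex.ofReal_zero, mul_zero, norm_zero]; exact hh0 0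
    have hnr : (0 : ℝ) < n := Nat.cast_pos.mpr hnpos
    rw [norm_mul, norm_mul, Complex.norm_real, Real.norm_of_nonneg (by positivity), hh]
    dsimp only
    rw [if_neg hnpos.ne']
    calc ‖w n‖ * ‖cuspCoeff g n‖ * (Real.exp (-(2 * Real.pi * n) * Y') / n)
        ≤ K * (C * (n : ℝ) ^ θ) * (Real.exp (-(2 * Real.pi * n) * Y') / n) := by
          gcongr
          · exact hw n
          · exact hb n
      _ = K * C * ((n : ℝ) ^ (θ - 1) * Real.exp (-c * n)) := by
          rw [Real.rpow_sub_one hnr.ne', hc]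
          field_simp
  -- `∑ h ≤ K C (1 + Γ c^{-θ})`
  have htsum : ∑' n, h n ≤ K * C * (1 + Real.Gamma θ * c ^ (-θ)) := by
    have h0 : h 0 = 0 := by simp only [hh, if_pos rfl]
    rw [hh_summable.tsum_eq_zero_add, h0, zero_add]
    have h' : ∀ n : ℕ, h (n + 1) = K * C *
        ((((n + 1 : ℕ) : ℝ)) ^ (θ - 1) * Real.exp (-c * ((n + 1 : ℕ) : ℝ))) := fun n ↦ by
      simp only [hh, if_neg (Nat.succ_ne_zero n)]
    simp only [h']
    rw [tsum_mul_left]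
    refine mul_le_mul_of_nonneg_left ?_ (by positivity)
    refine Real.tsum_le_of_sum_range_le (fun n ↦ by positivity) fun M ↦ ?_
    exact sum_range_rpow_mul_exp_le hθ hθ1 hcpos M
  rw [dampedTwist]
  exact (tsum_of_norm_bounded hh_summable.hasSum hpt).trans htsum

/-- **The dual-term error with weight `χ(Q)`.** For a cusp form `g ∈ S_2(Γ₀(N))` with
`|bₙ| ≤ C n^θ` (`0 < θ ≤ 1`), `p ∤ Q`, `m ≥ 1`, `Y' > 0`:
`‖D_g(B_Q, Y')‖ ≤ #𝔛_m · C · (4p² · 4p^{⌈m/2⌉}) · (1 + Γ(θ)(2πY')^{-θ})`, where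
`B_Q(n) = ∑_{χ ∈ 𝔛_m} χ(Q) τ(χ)² χ̄(n)` is bounded by the Kloosterman estimate
`norm_sum_wildChars_mul_gaussSum_sq_le` at the unit `Q n⁻¹`. The case `Q = N` (`p ∤ N`) is
`norm_dampedTwist_dual_le`. [folklore] -/
theorem norm_dampedTwist_dual_le_of_not_dvd {Q : ℕ} {m : ℕ} [NeZero (p ^ m)] (hm : m ≠ 0)
    (hpQ : ¬ p ∣ Q) {C θ : ℝ}
    (hC : 0 ≤ C) (hθ : 0 < θ) (hθ1 : θ ≤ 1) (hb : ∀ n : ℕ, ‖cuspCoeff g n‖ ≤ C * (n : ℝ) ^ θ)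
    {Y' : ℝ} (hY' : 0 < Y') :
    ‖dampedTwist g (fun n ↦ ∑ χ ∈ wildChars p m,
        χ Q * gaussSum χ (ZMod.stdAddChar (N := p ^ m)) ^ 2 * χ⁻¹ n) Y'‖ ≤
      (wildChars p m).card * (C * (((4 * p * p : ℕ) * (4 * (p : ℝ) ^ (m - m / 2))) *
        (1 + Real.Gamma θ * (2 * Real.pi * Y') ^ (-θ)))) := by
  classical
  set X := wildChars p m with hX
  set β : ℝ := (4 * p * p : ℕ) * (4 * (p : ℝ) ^ (m - m / 2)) with hβ
  have hβ0 : 0 ≤ β := by positivity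
  set Bw : ℕ → ℂ := fun n ↦ ∑ χ ∈ X, χ Q * gaussSum χ (ZMod.stdAddChar (N := p ^ m)) ^ 2 * χ⁻¹ n
    with hBw
  have hQu : IsUnit ((Q : ℕ) : ZMod (p ^ m)) := by
    rw [ZMod.isUnit_iff_coprime]
    exact ((Nat.Prime.coprime_iff_not_dvd hp.out).mpr hpQ).symm.pow_right m
  -- bound for the weight
  have hBle : ∀ n : ℕ, ‖Bw n‖ ≤ X.card * β := by
    intro n
    by_cases hn : IsUnit ((n : ℕ) : ZMod (p ^ m))
    · have : Bw n = ∑ χ ∈ X, χ ((Q : ZMod (p ^ m)) * ((n : ℕ) : ZMod (p ^ m))⁻¹) *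
          gaussSum χ (ZMod.stdAddChar (N := p ^ m)) ^ 2 := by
        refine Finset.sum_congr rfl fun χ _ ↦ ?_
        rw [← mul_inv_apply_eq χ _ hn]; ring
      rw [this]
      have hyu : IsUnit ((Q : ZMod (p ^ m)) * ((n : ℕ) : ZMod (p ^ m))⁻¹) := by
        refine hQu.mul ?_
        rw [← hn.unit_spec, ZMod.inv_coe_unit]; exact Units.isUnit _
      have h := norm_sum_wildChars_mul_gaussSum_sq_le hm hyu
      rw [hβ, hX]
      refine h.trans (le_of_eq ?_)
      push_cast; ring
    · have : Bw n = 0 := Finset.sum_eq_zero fun χ _ ↦ by rw [MulChar.map_nonunit χ⁻¹ hn, mul_zero]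
      rw [this, norm_zero]; positivity
  have h := norm_dampedTwist_weight_le g hC hθ hθ1 hb (by positivity : 0 ≤ (X.card : ℝ) * β)
    hBle hY'
  rw [hBw] at h
  refine h.trans (le_of_eq ?_)
  rw [hβ]; ring

end Errors

end Summit.BirchSwinnertonDyer.BirchSwinnertonDyer.Theorems.PSTwistedMomentAtLevel

end
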